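import Summits.BirchSwinnertonDyer.BirchSwinnertonDyer.Theses.GenusKolyvaginAtTwo
import HarnessLib

/-!
# Route `GenusKolyvaginAtTwo`, crux U₂ `MinimalTwinBSDTwo` (stmt-BirchSwinnertonDyer-22985): U₂ ⟺ U₂♯ ∧ OFF♯ — the restatement kit
# for the pen's pricing question (gk2-p3 g29 itemisation candidate (i) «U₂ ↦ U₂♯ := hTw0♯ ∧ hTw1♯»)

Seat `bsd-line-gk2-p2` g25 (PROVER seat 2/3, cell `bsd-f1-sign2`; LINE 23 holder), `--supports stmt-BirchSwinnertonDyer-22985` (helper; closes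
nothing).  THEOREMS ONLY (no definition, no named fact, no `sorry`); PURE LOGIC over the route decl; standard axioms.  **BSD is NOT proved by this
file; U₂ / U₂♯ / OFF♯ are NOT proved; no item is closed.**

THE POINT (planner currency).  `closes` (rev 57–59) consumes U₂ ONLY on the two Tamagawa cells with SURJECTIVE 2-ADIC IMAGE (gk2-p3 g29,
`Ledger.Line25.nonCMAtTwo_of_items_of_tamagawaSlicedSharpTwin_line25`, p772295 §3):
  hTw0♯ = «non-CM, `r_an = 1`, `#Sel₂ = 2`, `ρ̄_{W,2ⁿ}` onto ∀ n, `0 < Δ`, `ord₂ C = 0` ⟹ BSD₂»,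
  hTw1♯ = «… `Δ < 0`, `ord₂ C = 1` ⟹ BSD₂».
This file records, as kernel facts with the cell texts VERBATIM, that the item U₂ is EXACTLY «U₂♯ ∧ OFF♯» where OFF♯ is the complement inside U₂'s own
quantifier (small 2-adic image, or (Δ<0 ∧ ord₂ C ≠ 1), or (Δ>0 ∧ ord₂ C ≠ 0)) — the declared residual of LINE 23 v1.6 (`Cruxes/MinimalTwinBSDTwo/Lines/
twin_swap.lean`), never handed to U₂ by `closes`.  So a restatement U₂ ↦ U₂♯ loses nothing the route uses and drops exactly OFF♯:
* §1 `minimalTwinBSDTwo_iff_sharpCells_and_offCells` : `MinimalTwinBSDTwo ↔ (hTw0♯ ∧ hTw1♯) ∧ OFF♯`;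
* §2 the three projections / the assembly, for by-name use by the pen's render and by the LINE 23 skeleton.
[folklore] logic only.  References (for the cell texts): [Kramer1981] §2 Prop. 3; [DokchitserDokchitserMathZ2012, Theorem (1)–(3)].
-/

set_option autoImplicit false
set_option linter.dupNamespace false -- `Summit.<P>.<Sub>` repeats `BirchSwinnertonDyer` (D-0017)

namespace Summit.BirchSwinnertonDyer.BirchSwinnertonDyer.Theorems.GenusExact.TwinSwap.SharpSplit

open WeierstrassCurve Literature.NumberTheory.EllipticCurves
open Summit.BirchSwinnertonDyer.BirchSwinnertonDyer.Theses.GenusKolyvaginAtTwo (MinimalTwinBSDTwo)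

/-- **U₂ ⟺ (hTw0♯ ∧ hTw1♯) ∧ OFF♯.**  The crux `MinimalTwinBSDTwo` (BSD₂ for every non-CM globally minimal `W` with `r_an = 1`, `#Sel₂ = 2`) is
equivalent to the conjunction of its two ♯-CELLS (the only part `closes` consumes — texts VERBATIM from gk2-p3's ♯-sliced ledger, p772295 §3) and
the declared residual OFF♯ (small 2-adic image ∨ (Δ<0 ∧ ord₂ C ≠ 1) ∨ (Δ>0 ∧ ord₂ C ≠ 0)).  Pure logic: an elliptic curve has `Δ ≠ 0`. [folklore] -/
theorem minimalTwinBSDTwo_iff_sharpCells_and_offCells :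
    MinimalTwinBSDTwo ↔
      ((∀ (W : WeierstrassCurve ℚ) [W.IsElliptic] [W.IsGloballyMinimal], ¬ W.HasCM → W.analyticRank = 1 →
          Nat.card (W.selmerGroup 2) = 2 → (∀ n : ℕ, W.HasSurjectiveModNGaloisRep ((2 ^ n : ℕ) : ℤ)) → 0 < W.Δ →
          padicValNat 2 W.tamagawaProduct = 0 → BSDp W 2) ∧
        (∀ (W : WeierstrassCurve ℚ) [W.IsElliptic] [W.IsGloballyMinimal], ¬ W.HasCM → W.analyticRank = 1 →
          Nat.card (W.selmerGroup 2) = 2 → (∀ n : ℕ, W.HasSurjectiveModNGaloisRep ((2 ^ n : ℕ) : ℤ)) → W.Δ < 0 →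
          padicValNat 2 W.tamagawaProduct = 1 → BSDp W 2)) ∧
      (∀ (W : WeierstrassCurve ℚ) [W.IsElliptic] [W.IsGloballyMinimal],
        ¬ W.HasCM → W.analyticRank = 1 → Nat.card (W.selmerGroup 2) = 2 →
          (¬ (∀ n : ℕ, W.HasSurjectiveModNGaloisRep ((2 ^ n : ℕ) : ℤ)) ∨
            (W.Δ < 0 ∧ padicValNat 2 W.tamagawaProduct ≠ 1) ∨ (0 < W.Δ ∧ padicValNat 2 W.tamagawaProduct ≠ 0)) →
          BSDp W 2) := by
  constructor
  · intro h
    exact ⟨⟨fun W _ _ hcm hr hSel _ _ _ ↦ h W hcm hr hSel, fun W _ _ hcm hr hSel _ _ _ ↦ h W hcm hr hSel⟩,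
      fun W _ _ hcm hr hSel _ ↦ h W hcm hr hSel⟩
  · rintro ⟨⟨h0, h1⟩, hoff⟩ W _ _ hcm hr hSel
    have hΔ : W.Δ ≠ 0 := by rw [← WeierstrassCurve.coe_Δ']; exact W.Δ'.ne_zero
    by_cases hρ : ∀ n : ℕ, W.HasSurjectiveModNGaloisRep ((2 ^ n : ℕ) : ℤ)
    · rcases lt_or_gt_of_ne hΔ with hneg | hpos
      · by_cases hC1 : padicValNat 2 W.tamagawaProduct = 1
        · exact h1 W hcm hr hSel hρ hneg hC1
        · exact hoff W hcm hr hSel (Or.inr (Or.inl ⟨hneg, hC1⟩))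
      · by_cases hC0 : padicValNat 2 W.tamagawaProduct = 0
        · exact h0 W hcm hr hSel hρ hpos hC0
        · exact hoff W hcm hr hSel (Or.inr (Or.inr ⟨hpos, hC0⟩))
    · exact hoff W hcm hr hSel (Or.inl hρ)

/-- U₂ ⟹ hTw0♯ (projection). [folklore] -/
theorem hTw0Sharp_of_minimalTwinBSDTwo (h : MinimalTwinBSDTwo) :
    ∀ (W : WeierstrassCurve ℚ) [W.IsElliptic] [W.IsGloballyMinimal], ¬ W.HasCM → W.analyticRank = 1 →
      Nat.card (W.selmerGroup 2) = 2 → (∀ n : ℕ, W.HasSurjectiveModNGaloisRep ((2 ^ n : ℕ) : ℤ)) → 0 < W.Δ →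
      padicValNat 2 W.tamagawaProduct = 0 → BSDp W 2 :=
  (minimalTwinBSDTwo_iff_sharpCells_and_offCells.mp h).1.1

/-- U₂ ⟹ hTw1♯ (projection). [folklore] -/
theorem hTw1Sharp_of_minimalTwinBSDTwo (h : MinimalTwinBSDTwo) :
    ∀ (W : WeierstrassCurve ℚ) [W.IsElliptic] [W.IsGloballyMinimal], ¬ W.HasCM → W.analyticRank = 1 →
      Nat.card (W.selmerGroup 2) = 2 → (∀ n : ℕ, W.HasSurjectiveModNGaloisRep ((2 ^ n : ℕ) : ℤ)) → W.Δ < 0 →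
      padicValNat 2 W.tamagawaProduct = 1 → BSDp W 2 :=
  (minimalTwinBSDTwo_iff_sharpCells_and_offCells.mp h).1.2

/-- **U₂ ⟸ hTw0♯ + hTw1♯ + OFF♯** (assembly; the shape of LINE 23 v1.6's composition one level up). [folklore] -/
theorem minimalTwinBSDTwo_of_sharpCells_of_offCells
    (h0 : ∀ (W : WeierstrassCurve ℚ) [W.IsElliptic] [W.IsGloballyMinimal], ¬ W.HasCM → W.analyticRank = 1 →
      Nat.card (W.selmerGroup 2) = 2 → (∀ n : ℕ, W.HasSurjectiveModNGaloisRep ((2 ^ n : ℕ) : ℤ)) → 0 < W.Δ →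
      padicValNat 2 W.tamagawaProduct = 0 → BSDp W 2)
    (h1 : ∀ (W : WeierstrassCurve ℚ) [W.IsElliptic] [W.IsGloballyMinimal], ¬ W.HasCM → W.analyticRank = 1 →
      Nat.card (W.selmerGroup 2) = 2 → (∀ n : ℕ, W.HasSurjectiveModNGaloisRep ((2 ^ n : ℕ) : ℤ)) → W.Δ < 0 →
      padicValNat 2 W.tamagawaProduct = 1 → BSDp W 2)
    (hoff : ∀ (W : WeierstrassCurve ℚ) [W.IsElliptic] [W.IsGloballyMinimal],
      ¬ W.HasCM → W.analyticRank = 1 → Nat.card (W.selmerGroup 2) = 2 →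
        (¬ (∀ n : ℕ, W.HasSurjectiveModNGaloisRep ((2 ^ n : ℕ) : ℤ)) ∨
          (W.Δ < 0 ∧ padicValNat 2 W.tamagawaProduct ≠ 1) ∨ (0 < W.Δ ∧ padicValNat 2 W.tamagawaProduct ≠ 0)) →
        BSDp W 2) :
    MinimalTwinBSDTwo :=
  minimalTwinBSDTwo_iff_sharpCells_and_offCells.mpr ⟨⟨h0, h1⟩, hoff⟩

end Summit.BirchSwinnertonDyer.BirchSwinnertonDyer.Theorems.GenusExact.TwinSwap.SharpSplit
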